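import Summits.HubbardSuperconductivity.HubbardSuperconductivity.Theorems.NodalWardXYDefs

/-!
# `PerturbedXYOrder` (stmt-HubbardSuperconductivity-10739) — line `schwarz-inheritance`, lead skeleton

Crux (route `NodalWardXY`, rank 3): `Summit.HubbardSuperconductivity.HubbardSuperconductivity.Theses.NodalWardXY.PerturbedXYOrder`
— for the classical XY model on `(ℤ/Lℤ)³` at `J ≥ J₀`, perturbed by a complex two-current kernel `K` with
`‖K(b,b')‖ ≤ ε(1+dist)⁻⁴`: `Z_K ≠ 0` and `Re[num/Z_K/L⁶] ≥ a > 0`, uniformly in `L ≥ 2`.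

Line (card `Cruxes/PerturbedXYOrder/Ideas/schwarz-inheritance.md`): the admissible class is balanced and
`z ↦ Z_L(zK)`, `z ↦ num_L(zK)` are ENTIRE, so
* (Schwarz) STABILITY on a larger radius `ε₁` (`Z ≠ 0` and `‖cratio‖ ≤ B`) + the REAL `K = 0` plateau `≥ a₀`
  give the crux at radius `ε₁ a₀/(4B)` with `a = a₀/2` (`stub_schwarzInheritance`, pure complex analysis);
* (Cauchy–Taylor) stability at radius `ε₁/(2A)` with `B = ‖cratio 0‖ + 1 ≤ 2` follows from `n! Aⁿ`-bounds on the
  Taylor coefficients at `t = 0` of `log(Z(tK)/Z(0))` (cumulants of `W_K` under the REAL Gibbs state, `× L³`) and of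
  `cratio(tK)` (mixed cumulants with the order observable) (`stub_stabilityOfTaylorBounds`, pure complex analysis;
  `stub_cumulantBounds`, the crux-sized estimate: uniformity in `L` and `J ≥ J₀` of Gevrey-1 truncated-current bounds
  of the low-temperature rotator — held by the lead);
* the `K = 0` plateau for ALL `L ≥ 2`: even `L ≥ 4` is Fröhlich–Simon–Spencer (tree: `FriedliVelenik2017_nVector_infraredBound_holds`,
  `PlaneRotatorLROProofs`) (`stub_realPlateauEven`); odd `L` and `L = 2` need the reflection-positivity-free route
  (tree: `GarbanSpencer2022_xyLongRangeOrder_holds` on a free sub-box + Ginibre `ginibreExpect_reChar_mono`) for large odd `L`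
  (`stub_realPlateauOdd`), and Griffiths' first inequality (`stub_twoPointNonneg`) + the diagonal `≥ L⁻³` on the finitely many
  small tori (`inv_cube_le_re_cratio_zero`, proved here);
* analyticity in the coupling (`stub_entire`: `t ↦ Z(tK)`, `t ↦ num(tK)` differentiable on `ℂ` — parametric integrals of
  `exp(t W_K) w_J` over the compact cube).
Composition `PerturbedXYOrder_of` below is sorry-free modulo the seven stubs (pure logic + the elementary facts
`Zk J 0 ≠ 0`, `‖cratio L J 0‖ ≤ 1` proved here).

Disproof used (`Cruxes/PerturbedXYOrder/Disproof.lean`, v2): `PerturbedXYOrderAllJ` FALSE ⇒ every stub that asserts order or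
bounds carries `J₀ ≤ J` (`stub_realPlateau*`, `stub_cumulantBounds`); the two complex-analysis stubs are pointwise in `J`;
§3/§3a (`W_K` extensive, `Z_K/Z_0` exponentially small) ⇒ zero-freeness is derived from CONVERGENCE of `log(Z(tK)/Z(0))`
(Taylor radius `1/A` uniform in `L`), never from smallness of `e^{W} − 1`; `Exp p ≤ 3` FALSE ⇒ exponent 4 enters only through
`stub_cumulantBounds` (where `A` must be uniform in `L`); `Zk_ne_zero_of_small_volume` not needed.

VOCABULARY: `Bond, cube, cur, wJ, Wk, Zk, num, cratio, Admissible, perturbedXYOrder_iff` are the landed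
`Theorems/NodalWardXYDefs.lean` (p76365, namespace `…Theorems.PerturbedXYOrder`) = the crux's own lets; stub files are stated and
landed in that namespace (`Theorems/NodalWardXYPerturbedXYOrder<Stub>.lean`).
-/

noncomputable section

namespace Summit.HubbardSuperconductivity.HubbardSuperconductivity.Cruxes.PerturbedXYOrder.SchwarzLine

open MeasureTheory Literature.Probability.LatticeModels
open Summit.HubbardSuperconductivity.HubbardSuperconductivity.Theses.NodalWardXY
open Summit.HubbardSuperconductivity.HubbardSuperconductivity.Theorems.PerturbedXYOrder

/-! ### The seven stubs (registered on stmt-HubbardSuperconductivity-10739) -/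

/-- STUB (M; in print): **the `K = 0` plateau on EVEN tori `L ≥ 4`** — Fröhlich–Simon–Spencer 1976 infrared bound,
`⟨‖m_L‖²⟩ ≥ 1 − torusGreen_L(0)/J` for even `L ≥ 4` (tree: `FriedliVelenik2017_nVector_infraredBound_holds` clause (2) with the
change of variables of `PlaneRotatorLROProofs`), plus a bound on `torusGreen_L(0)` uniform in even `L`
(`torusGreen_tendsto_latticeGreen` + finitely many small `L`). [cite: FriedliVelenikSMLS2017, Thm 10.25 with Thm 10.24] -/
theorem stub_realPlateauEven :
    ∃ J₁ a₀ : ℝ, 0 < a₀ ∧ ∀ J : ℝ, J₁ ≤ J → ∀ (L : ℕ) [NeZero L], Even L → 4 ≤ L → a₀ ≤ (cratio L J 0).re := by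
  sorry

/-- STUB (XL glue over proved tree theorems; not in print as stated): **the `K = 0` plateau on large ODD tori**, where
reflection positivity is silent: the RP-free long-range order of Garban–Spencer 2022 on a free sub-box of the torus (tree:
`GarbanSpencer2022_xyLongRangeOrder_holds`, pairs `x, y` whose ball `B((x+y)/2, 2‖x−y‖)` stays inside the box: a positive
fraction `c L⁶` of all pairs), Ginibre's inequality to pass from the free box to the torus (tree: `ginibreExpect_reChar_mono`,
template `GinibreU1TorusGeFreeBoxD4_holds`) and `⟨cos(θ_x − θ_y)⟩ ≥ 0` for the other pairs. (The proof works for every parity;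
even tori are served by `stub_realPlateauEven`.) [cite: GarbanSpencer2022, Thm 1.3 with Remark 1] -/
theorem stub_realPlateauOdd :
    ∃ J₁ a₀ : ℝ, ∃ L₁ : ℕ, 0 < a₀ ∧ ∀ J : ℝ, J₁ ≤ J → ∀ (L : ℕ) [NeZero L], Odd L → L₁ ≤ L →
      a₀ ≤ (cratio L J 0).re := by
  sorry

/-- STUB (L): **Griffiths' first inequality for the torus rotator**: every two-point function `∫ cos(θ_x − θ_y) e^{J Σ cos ∇θ} dθ`
on `[0,2π]^Λ` is non-negative for `J ≥ 0` (Ginibre 1970; in the tree as the monotonicity `ginibreExpect_reChar_mono` on the compact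
abelian group `U(1)^Λ`, comparing couplings `J` and `0`, after the change of variables `θ ↦ (e^{iθ_x})_x`; or directly by expanding
`e^{J cos}` in non-negative Fourier–Bessel coefficients). Used for the finitely many small tori (plateau `≥ L⁻³`, diagonal terms).
[cite: Ginibre1970, main theorem with the plane-rotator example] -/
theorem stub_twoPointNonneg :
    ∀ (J : ℝ), 0 ≤ J → ∀ (L : ℕ) [NeZero L] (x y : TorusSite 3 L),
      0 ≤ ∫ θ in cube L, Real.cos (θ x - θ y) * Real.exp (J * ∑ b : Bond L, Real.cos (θ (b.1 + Pi.single b.2 1) - θ b.1)) := by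
  sorry

/-- STUB (M): **analyticity in the coupling.** For fixed `J, L, K` the maps `t ↦ Z(tK)` and `t ↦ num(tK)` are complex
differentiable on all of `ℂ` (integrals over the compact cube of `w_J(θ) exp(t W_K(θ))`, entire in `t` with locally
uniformly bounded derivative `W_K w_J e^{tW_K}`: `hasDerivAt_integral_of_dominated_loc_of_deriv_le`). [folklore] -/
theorem stub_entire :
    ∀ (J : ℝ) (L : ℕ) [NeZero L] (K : Bond L → Bond L → ℂ),
      Differentiable ℂ (fun t : ℂ => Zk J (t • K)) ∧ Differentiable ℂ (fun t : ℂ => num J (t • K)) := by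
  sorry

/-- STUB (M): **Schwarz inheritance.** If on radius `ε₁` every admissible kernel has `Z ≠ 0` and complex plateau of norm
`≤ B`, and the real `K = 0` plateau is `≥ a₀ > 0`, then every kernel admissible at radius `ε₁ a₀ /(4B)` has `Z ≠ 0` and
`Re cratio ≥ a₀/2`: `g(z) = cratio(zK)` is holomorphic and bounded by `B` on the ball `‖z‖ < 4B/a₀` (where `zK` is
admissible at radius `ε₁`), so the Schwarz lemma (`Complex.dist_le_div_mul_dist_of_mapsTo_ball`) gives
`‖g(1) − g(0)‖ ≤ 2B · a₀/(4B) = a₀/2`. [folklore] -/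
theorem stub_schwarzInheritance :
    ∀ (J : ℝ) (L : ℕ) [NeZero L] (ε₁ B a₀ : ℝ), 0 < ε₁ → 0 < a₀ →
      (∀ K : Bond L → Bond L → ℂ,
        Differentiable ℂ (fun t : ℂ => Zk J (t • K)) ∧ Differentiable ℂ (fun t : ℂ => num J (t • K))) →
      (∀ K : Bond L → Bond L → ℂ, Admissible L ε₁ K → Zk J K ≠ 0 ∧ ‖cratio L J K‖ ≤ B) →
      a₀ ≤ (cratio L J 0).re →
      ∀ K : Bond L → Bond L → ℂ, Admissible L (ε₁ * a₀ / (4 * B)) K →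
        Zk J K ≠ 0 ∧ a₀ / 2 ≤ (cratio L J K).re := by
  sorry

/-- STUB (M/L): **stability from Taylor bounds (Cauchy–Taylor half of the lever).** If the Taylor coefficients at `t = 0`
of `log(Z(tK)/Z(0))` are bounded by `Aⁿ V` and those of `cratio(tK)` by `Aⁿ` (`n ≥ 1`), then on `‖t‖ ≤ 1/(2A)`:
`Z(tK) ≠ 0` (the series `g` of the log converges on `‖t‖ < 1/A`, `exp ∘ g = Z(tK)/Z(0)` near `0`, hence on the ball by the
identity theorem, `Z(tK)` entire) and `‖cratio(tK) − cratio(0)‖ ≤ Σ_{n≥1} 2⁻ⁿ = 1` (Taylor series of the holomorphic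
`cratio(tK)` on the ball `‖t‖ < 1/A`, `Complex.taylorSeries_eq_on_ball`). [folklore] -/
theorem stub_stabilityOfTaylorBounds :
    ∀ (J : ℝ) (L : ℕ) [NeZero L] (K : Bond L → Bond L → ℂ) (A V : ℝ), 0 < A → 0 ≤ V →
      Differentiable ℂ (fun t : ℂ => Zk J (t • K)) → Differentiable ℂ (fun t : ℂ => num J (t • K)) →
      Zk J (0 : Bond L → Bond L → ℂ) ≠ 0 →
      (∀ n : ℕ, 1 ≤ n →
        ‖iteratedDeriv n (fun t : ℂ => Complex.log (Zk J (t • K) / Zk J (0 : Bond L → Bond L → ℂ))) 0‖ ≤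
          (n.factorial : ℝ) * A ^ n * V) →
      (∀ n : ℕ, 1 ≤ n → ‖iteratedDeriv n (fun t : ℂ => cratio L J (t • K)) 0‖ ≤ (n.factorial : ℝ) * A ^ n) →
      ∀ t : ℂ, ‖t‖ ≤ 1 / (2 * A) → Zk J (t • K) ≠ 0 ∧ ‖cratio L J (t • K) - cratio L J 0‖ ≤ 1 := by
  sorry

/-- STUB (XL, crux-sized — held by the line lead): **Gevrey-1 truncated-current bounds of the low-temperature rotator,
uniform in the volume.** There are `J₀, ε₁, A` such that for `J ≥ J₀`, `L ≥ 2` and `K` admissible at radius `ε₁`, the Taylor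
coefficients at `t = 0` of `log(Z(tK)/Z(0))` (`= κ_n(W_K)/n!`, cumulants under the REAL Gibbs state `μ_{J,L}`) are bounded by
`Aⁿ L³` and those of the complex plateau `cratio(tK)` (mixed cumulants `⟨O_L; W_K; …; W_K⟩`) by `Aⁿ`. Spin-wave value
`κ_n = 2^{n-1}(n-1)! Tr[(KP/J)ⁿ]`, `‖K‖_{ℓ²→ℓ²} ≤ 3 S_∞ ε` (bounded-operator algebra); the content is the anharmonic/vortex
corrections at large `J` — a positivity-free low-temperature cluster property (Balaban 1995–98 / Balaban–O'Carroll 1999 class),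
unprinted. [cite: BalabanOcarroll1999, low-temperature expansion (nearest engine; the stated bound is not in print)] -/
theorem stub_cumulantBounds :
    ∃ J₀ ε₁ A : ℝ, 0 < ε₁ ∧ 0 < A ∧ ∀ J : ℝ, J₀ ≤ J → ∀ (L : ℕ) [NeZero L], 2 ≤ L →
      ∀ K : Bond L → Bond L → ℂ, Admissible L ε₁ K →
        (∀ n : ℕ, 1 ≤ n →
          ‖iteratedDeriv n (fun t : ℂ => Complex.log (Zk J (t • K) / Zk J (0 : Bond L → Bond L → ℂ))) 0‖ ≤
            (n.factorial : ℝ) * A ^ n * (L : ℝ) ^ 3) ∧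
        (∀ n : ℕ, 1 ≤ n → ‖iteratedDeriv n (fun t : ℂ => cratio L J (t • K)) 0‖ ≤ (n.factorial : ℝ) * A ^ n) := by
  sorry

/-! ### Elementary facts used by the composition (proved) -/

variable {L : ℕ}

/-- Admissibility is monotone in the radius. -/
theorem admissible_mono [NeZero L] {ε ε' : ℝ} (h : ε ≤ ε') {K : Bond L → Bond L → ℂ}
    (hK : Admissible L ε K) : Admissible L ε' K := fun b b' =>
  (hK b b').trans (div_le_div_of_nonneg_right h (by positivity))

/-- Scaling: `c • K` is admissible at radius `|c| ε`-type bound: if `K` is admissible at radius `ε` and `‖c‖ * ε ≤ ε'`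
then `c • K` is admissible at radius `ε'`. -/
theorem admissible_smul [NeZero L] {ε ε' : ℝ} {c : ℂ} (hc : ‖c‖ * ε ≤ ε') {K : Bond L → Bond L → ℂ}
    (hK : Admissible L ε K) : Admissible L ε' (c • K) := by
  intro b b'
  have hd : (0:ℝ) < (1 + ((torusGraph 3 L).dist b.1 b'.1 : ℝ)) ^ 4 := by positivity
  calc ‖(c • K) b b'‖ = ‖c‖ * ‖K b b'‖ := by simp
    _ ≤ ‖c‖ * (ε / (1 + ((torusGraph 3 L).dist b.1 b'.1 : ℝ)) ^ 4) :=
        mul_le_mul_of_nonneg_left (hK b b') (norm_nonneg _)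
    _ = (‖c‖ * ε) / (1 + ((torusGraph 3 L).dist b.1 b'.1 : ℝ)) ^ 4 := by ring
    _ ≤ ε' / (1 + ((torusGraph 3 L).dist b.1 b'.1 : ℝ)) ^ 4 := div_le_div_of_nonneg_right hc hd.le

/-- `W_0 = 0`. -/
theorem Wk_zero [NeZero L] (θ : TorusSite 3 L → ℝ) : Wk (0 : Bond L → Bond L → ℂ) θ = 0 := by
  simp [Wk]

/-- The real (unperturbed) weight `e^{J Σ cos}`. -/
def w0 [NeZero L] (J : ℝ) (θ : TorusSite 3 L → ℝ) : ℝ :=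
  Real.exp (J * ∑ b : Bond L, Real.cos (θ (b.1 + Pi.single b.2 1) - θ b.1))

theorem continuous_w0 [NeZero L] (J : ℝ) : Continuous (w0 (L := L) J) := by
  unfold w0; fun_prop

theorem w0_pos [NeZero L] (J : ℝ) (θ : TorusSite 3 L → ℝ) : 0 < w0 J θ := Real.exp_pos _

theorem isCompact_cube : IsCompact (cube L) := isCompact_univ_pi fun _ => isCompact_Icc

theorem volume_cube_pos [NeZero L] : 0 < MeasureTheory.volume (cube L) := by
  unfold cube
  rw [MeasureTheory.volume_pi_pi]
  refine pos_iff_ne_zero.2 (Finset.prod_ne_zero_iff.2 fun x _ => ?_)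
  rw [Real.volume_Icc]
  exact (ENNReal.ofReal_pos.2 (by linarith [Real.pi_pos])).ne'

/-- `Z_0` is the (complexified) integral of the positive real weight. -/
theorem Zk_zero_eq [NeZero L] (J : ℝ) :
    Zk J (0 : Bond L → Bond L → ℂ) = ((∫ θ in cube L, w0 J θ : ℝ) : ℂ) := by
  unfold Zk
  have : (fun θ : TorusSite 3 L → ℝ => wJ J θ * Complex.exp (Wk (0 : Bond L → Bond L → ℂ) θ)) =
      fun θ => ((w0 J θ : ℝ) : ℂ) := by
    funext θ; rw [Wk_zero, Complex.exp_zero, mul_one]; rfl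
  rw [this, integral_complex_ofReal]

/-- The real unperturbed partition function is positive. -/
theorem integral_w0_pos [NeZero L] (J : ℝ) : 0 < ∫ θ in cube L, w0 (L := L) J θ := by
  have hint : IntegrableOn (w0 (L := L) J) (cube L) volume :=
    (continuous_w0 J).continuousOn.integrableOn_compact isCompact_cube
  rw [integral_pos_iff_support_of_nonneg (fun θ => (w0_pos J θ).le) hint]
  have hsupp : Function.support (w0 (L := L) J) = Set.univ :=
    Set.eq_univ_of_forall fun θ => (w0_pos J θ).ne'
  rw [hsupp, Measure.restrict_apply_univ]
  exact volume_cube_pos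

/-- `Z_0 ≠ 0`. -/
theorem Zk_zero_ne_zero [NeZero L] (J : ℝ) : Zk J (0 : Bond L → Bond L → ℂ) ≠ 0 := by
  rw [Zk_zero_eq, Ne, Complex.ofReal_eq_zero]
  exact (integral_w0_pos J).ne'

/-- The numerator at `K = 0` is the (complexified) real integral `Σ_{x,y} ∫ cos(θ_x − θ_y) w_0`. -/
theorem num_zero_eq [NeZero L] (J : ℝ) :
    num J (0 : Bond L → Bond L → ℂ) =
      ((∑ x : TorusSite 3 L, ∑ y : TorusSite 3 L, ∫ θ in cube L, Real.cos (θ x - θ y) * w0 J θ : ℝ) : ℂ) := by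
  have hxy : ∀ x y : TorusSite 3 L,
      (∫ θ in cube L, (Real.cos (θ x - θ y) : ℂ) * (wJ J θ * Complex.exp (Wk (0 : Bond L → Bond L → ℂ) θ))) =
        ((∫ θ in cube L, Real.cos (θ x - θ y) * w0 J θ : ℝ) : ℂ) := by
    intro x y
    have h : (fun θ : TorusSite 3 L → ℝ =>
        (Real.cos (θ x - θ y) : ℂ) * (wJ J θ * Complex.exp (Wk (0 : Bond L → Bond L → ℂ) θ))) =
        fun θ => ((Real.cos (θ x - θ y) * w0 J θ : ℝ) : ℂ) := by
      funext θ; rw [Wk_zero, Complex.exp_zero, mul_one, Complex.ofReal_mul]; rfl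
    rw [h, integral_complex_ofReal]
  unfold num
  rw [Complex.ofReal_sum]
  refine Finset.sum_congr rfl fun x _ => ?_
  rw [Complex.ofReal_sum]
  exact Finset.sum_congr rfl fun y _ => hxy x y

/-- `|Σ_{x,y} ∫ cos(θ_x − θ_y) w_0| ≤ L⁶ ∫ w_0`. -/
theorem abs_num_zero_le [NeZero L] (J : ℝ) :
    |∑ x : TorusSite 3 L, ∑ y : TorusSite 3 L, ∫ θ in cube L, Real.cos (θ x - θ y) * w0 J θ| ≤
      (L : ℝ) ^ 6 * ∫ θ in cube L, w0 (L := L) J θ := by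
  have hint : IntegrableOn (w0 (L := L) J) (cube L) volume :=
    (continuous_w0 J).continuousOn.integrableOn_compact isCompact_cube
  have hterm : ∀ x y : TorusSite 3 L,
      |∫ θ in cube L, Real.cos (θ x - θ y) * w0 J θ| ≤ ∫ θ in cube L, w0 (L := L) J θ := by
    intro x y
    have hci : IntegrableOn (fun θ : TorusSite 3 L → ℝ => Real.cos (θ x - θ y) * w0 J θ) (cube L) volume := by
      refine Continuous.continuousOn ?_ |>.integrableOn_compact isCompact_cube
      exact (by fun_prop : Continuous fun θ : TorusSite 3 L → ℝ => Real.cos (θ x - θ y)).mul (continuous_w0 J)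
    calc |∫ θ in cube L, Real.cos (θ x - θ y) * w0 J θ|
        ≤ ∫ θ in cube L, |Real.cos (θ x - θ y) * w0 J θ| := abs_integral_le_integral_abs
      _ ≤ ∫ θ in cube L, w0 J θ := by
          refine integral_mono_of_nonneg (ae_of_all _ fun θ => abs_nonneg _) hint (ae_of_all _ fun θ => ?_)
          show |Real.cos (θ x - θ y) * w0 J θ| ≤ w0 J θ
          rw [abs_mul, abs_of_pos (w0_pos J θ)]
          exact mul_le_of_le_one_left (w0_pos J θ).le (Real.abs_cos_le_one _)
  calc |∑ x : TorusSite 3 L, ∑ y : TorusSite 3 L, ∫ θ in cube L, Real.cos (θ x - θ y) * w0 J θ|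
      ≤ ∑ x : TorusSite 3 L, |∑ y : TorusSite 3 L, ∫ θ in cube L, Real.cos (θ x - θ y) * w0 J θ| :=
        Finset.abs_sum_le_sum_abs _ _
    _ ≤ ∑ x : TorusSite 3 L, ∑ y : TorusSite 3 L, |∫ θ in cube L, Real.cos (θ x - θ y) * w0 J θ| :=
        Finset.sum_le_sum fun x _ => Finset.abs_sum_le_sum_abs _ _
    _ ≤ ∑ x : TorusSite 3 L, ∑ y : TorusSite 3 L, ∫ θ in cube L, w0 (L := L) J θ := by
        gcongr with x _ y _; exact hterm x y
    _ = (L : ℝ) ^ 6 * ∫ θ in cube L, w0 (L := L) J θ := by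
        simp only [Finset.sum_const, Finset.card_univ, nsmul_eq_mul, Fintype.card_fun, Fintype.card_fin, ZMod.card]
        push_cast; ring

/-- `‖cratio L J 0‖ ≤ 1` (the real plateau is an average of cosines under a probability measure). -/
theorem norm_cratio_zero_le_one [NeZero L] (J : ℝ) : ‖cratio L J (0 : Bond L → Bond L → ℂ)‖ ≤ 1 := by
  have hZ := integral_w0_pos (L := L) J
  have hL : (0:ℝ) < (L : ℝ) ^ 6 := by
    have := NeZero.pos L; positivity
  unfold cratio
  rw [num_zero_eq, Zk_zero_eq, norm_div, norm_div, Complex.norm_real, Complex.norm_real, Real.norm_eq_abs,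
    Real.norm_eq_abs, abs_of_pos hZ]
  have : ‖((L : ℂ)) ^ 6‖ = (L : ℝ) ^ 6 := by simp
  rw [this, div_div, div_le_one (by positivity), mul_comm]
  exact abs_num_zero_le J

/-- Small tori: if all two-point functions are non-negative then the plateau is at least the diagonal contribution `L⁻³`. -/
theorem inv_cube_le_re_cratio_zero [NeZero L] {J : ℝ}
    (hnn : ∀ x y : TorusSite 3 L, 0 ≤ ∫ θ in cube L, Real.cos (θ x - θ y) * w0 J θ) :
    ((L : ℝ) ^ 3)⁻¹ ≤ (cratio L J (0 : Bond L → Bond L → ℂ)).re := by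
  have hZ := integral_w0_pos (L := L) J
  have hL0 : (0:ℝ) < (L : ℝ) := by exact_mod_cast NeZero.pos L
  have hre : (cratio L J (0 : Bond L → Bond L → ℂ)).re =
      (∑ x : TorusSite 3 L, ∑ y : TorusSite 3 L, ∫ θ in cube L, Real.cos (θ x - θ y) * w0 J θ) /
        (∫ θ in cube L, w0 (L := L) J θ) / (L : ℝ) ^ 6 := by
    unfold cratio
    rw [num_zero_eq, Zk_zero_eq]
    have : ((L : ℂ)) ^ 6 = (((L : ℝ) ^ 6 : ℝ) : ℂ) := by push_cast; ring
    rw [this, ← Complex.ofReal_div, ← Complex.ofReal_div, Complex.ofReal_re]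
  -- diagonal terms: `∫ cos 0 · w0 = Z₀`
  have hdiag : ∀ x : TorusSite 3 L, ∫ θ in cube L, Real.cos (θ x - θ x) * w0 J θ = ∫ θ in cube L, w0 (L := L) J θ := by
    intro x; refine integral_congr_ae (ae_of_all _ fun θ => ?_); simp
  have hsum : (L : ℝ) ^ 3 * ∫ θ in cube L, w0 (L := L) J θ ≤
      ∑ x : TorusSite 3 L, ∑ y : TorusSite 3 L, ∫ θ in cube L, Real.cos (θ x - θ y) * w0 J θ := by
    calc (L : ℝ) ^ 3 * ∫ θ in cube L, w0 (L := L) J θ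
        = ∑ x : TorusSite 3 L, ∫ θ in cube L, Real.cos (θ x - θ x) * w0 J θ := by
          simp only [hdiag, Finset.sum_const, Finset.card_univ, nsmul_eq_mul, Fintype.card_fun, Fintype.card_fin,
            ZMod.card]
          push_cast; ring
      _ ≤ ∑ x : TorusSite 3 L, ∑ y : TorusSite 3 L, ∫ θ in cube L, Real.cos (θ x - θ y) * w0 J θ := by
          refine Finset.sum_le_sum fun x _ => ?_
          rw [← Finset.add_sum_erase _ _ (Finset.mem_univ x)]
          exact le_add_of_nonneg_right (Finset.sum_nonneg fun y _ => hnn x y)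
  rw [hre, le_div_iff₀ (by positivity), le_div_iff₀ hZ]
  calc ((L : ℝ) ^ 3)⁻¹ * (L : ℝ) ^ 6 * ∫ θ in cube L, w0 (L := L) J θ
      = (L : ℝ) ^ 3 * ∫ θ in cube L, w0 (L := L) J θ := by field_simp
    _ ≤ _ := hsum

/-! ### Composition (sorry-free modulo the stubs) -/

/-- **The crux from the seven stubs.** Real plateau `a₀` for all `L ≥ 2` (even `L ≥ 4` / odd `L ≥ L₁` / diagonal `L⁻³` on small tori) · stability at radius `ε₁/(2A)` with
`B = 2` (entire + Taylor bounds + `‖cratio 0‖ ≤ 1`) · Schwarz inheritance ⇒ `PerturbedXYOrder` with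
`ε = ε₁/(2A) · a₀/8`, `a = a₀/2`. -/
theorem PerturbedXYOrder_of : PerturbedXYOrder := by
  rw [perturbedXYOrder_iff]
  obtain ⟨J₁, a₁, ha₁, hE⟩ := stub_realPlateauEven
  obtain ⟨J₂, a₂, L₁, ha₂, hO⟩ := stub_realPlateauOdd
  obtain ⟨J₃, ε₁, A, hε₁, hA, hC⟩ := stub_cumulantBounds
  -- the real plateau for every `L ≥ 2`: even `L ≥ 4` (FSS), odd `L ≥ L₁` (Garban–Spencer), the rest by the diagonal
  set a₃ : ℝ := ((max L₁ 4 : ℕ) : ℝ)⁻¹ ^ 3 with ha₃def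
  have ha₃ : 0 < a₃ := by positivity
  have hplat : ∀ J : ℝ, max (max (max J₁ J₂) J₃) 0 ≤ J → ∀ (L : ℕ) [NeZero L], 2 ≤ L →
      min (min a₁ a₂) a₃ ≤ (cratio L J 0).re := by
    intro J hJ L _ hL
    have hJ₁ : J₁ ≤ J := le_trans (le_trans (le_trans (le_max_left J₁ J₂) (le_max_left _ J₃)) (le_max_left _ 0)) hJ
    have hJ₂ : J₂ ≤ J := le_trans (le_trans (le_trans (le_max_right J₁ J₂) (le_max_left _ J₃)) (le_max_left _ 0)) hJ
    have hJ0 : 0 ≤ J := le_trans (le_max_right _ 0) hJ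
    by_cases h : Even L ∧ 4 ≤ L
    · exact (min_le_left _ _).trans ((min_le_left _ _).trans (hE J hJ₁ L h.1 h.2))
    by_cases h' : Odd L ∧ L₁ ≤ L
    · exact (min_le_left _ _).trans ((min_le_right _ _).trans (hO J hJ₂ L h'.1 h'.2))
    -- small torus: `L < max L₁ 4`
    have hsmall : L < max L₁ 4 := by
      rcases Nat.even_or_odd L with he | ho
      · have : ¬ 4 ≤ L := fun h4 => h ⟨he, h4⟩
        omega
      · have : ¬ L₁ ≤ L := fun h1 => h' ⟨ho, h1⟩
        omega
    refine (min_le_right _ _).trans (le_trans ?_ (inv_cube_le_re_cratio_zero fun x y => ?_))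
    · rw [ha₃def, inv_pow]
      have hL0 : (0:ℝ) < (L : ℝ) := by exact_mod_cast NeZero.pos L
      have hle : (L : ℝ) ≤ ((max L₁ 4 : ℕ) : ℝ) := by exact_mod_cast hsmall.le
      exact inv_anti₀ (by positivity) (pow_le_pow_left₀ hL0.le hle 3)
    · exact stub_twoPointNonneg J hJ0 L x y
  refine ⟨max (max (max J₁ J₂) J₃) 0, ε₁ / (2 * A) * min (min a₁ a₂) a₃ / (4 * 2), min (min a₁ a₂) a₃ / 2,
    by positivity, by positivity, ?_⟩
  intro J hJ L _ hL K hK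
  have hJ₃ : J₃ ≤ J := le_trans (le_trans (le_max_right _ J₃) (le_max_left _ 0)) hJ
  -- complex stability at radius `ε₁/(2A)` with `B = 2`
  have hstab : ∀ K' : Bond L → Bond L → ℂ, Admissible L (ε₁ / (2 * A)) K' →
      Zk J K' ≠ 0 ∧ ‖cratio L J K'‖ ≤ 2 := by
    intro K' hK'
    set c : ℝ := 2 * A with hc
    have hcpos : 0 < c := by positivity
    have hbig : Admissible L ε₁ (((c : ℝ) : ℂ) • K') := by
      refine admissible_smul (le_of_eq ?_) hK'
      rw [Complex.norm_real, Real.norm_eq_abs, abs_of_pos hcpos]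
      field_simp
    obtain ⟨h1, h2⟩ := hC J hJ₃ L hL _ hbig
    have hent := stub_entire J L (((c : ℝ) : ℂ) • K')
    have h3 := stub_stabilityOfTaylorBounds J L (((c : ℝ) : ℂ) • K') A ((L : ℝ) ^ 3) hA (by positivity)
      hent.1 hent.2 (Zk_zero_ne_zero J) h1 h2 (((1 / c : ℝ)) : ℂ) (by
        rw [Complex.norm_real, Real.norm_eq_abs, abs_of_pos (by positivity), hc])
    have hsmul : (((1 / c : ℝ)) : ℂ) • ((((c : ℝ) : ℂ)) • K') = K' := by
      rw [smul_smul, ← Complex.ofReal_mul, one_div_mul_cancel hcpos.ne', Complex.ofReal_one, one_smul]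
    rw [hsmul] at h3
    refine ⟨h3.1, ?_⟩
    calc ‖cratio L J K'‖ = ‖(cratio L J K' - cratio L J 0) + cratio L J 0‖ := by rw [sub_add_cancel]
      _ ≤ ‖cratio L J K' - cratio L J 0‖ + ‖cratio L J 0‖ := norm_add_le _ _
      _ ≤ 1 + 1 := add_le_add h3.2 (norm_cratio_zero_le_one J)
      _ = 2 := by norm_num
  exact stub_schwarzInheritance J L (ε₁ / (2 * A)) 2 (min (min a₁ a₂) a₃) (by positivity) (by positivity)
    (fun K' => stub_entire J L K') hstab (hplat J hJ L hL) K hK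

end Summit.HubbardSuperconductivity.HubbardSuperconductivity.Cruxes.PerturbedXYOrder.SchwarzLine

end
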